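import Literature.MathematicalPhysics.QuantumFieldTheory.Balaban1983to89.B5G0SettingTorus

/-!
# `Balaban1983to89.B5Pieces133Torus` — the cube pieces of (1.133) on Bałaban's tori: the decomposition
# VG₀J = Σ_{y″∈T₁} 1_{B(y″)}VG₀J, the entrywise form of (1.133) as finite sums over the unit lattice, and the located
# «weak bounds» leaf — the sup norm of a piece is bounded by the LOCALIZED L² norms of G₀J near y″ (Cauchy–Schwarz
# for the block averages Q′_k, Q_k), PROVED for the concrete operators

statement-level skeleton of published theorems with citation tags; proofs where landed; nothing here is a claim
about the Yang–Mills mass gap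

Source (lit-balaban / pub-balaban cells): T. Bałaban, *Propagators and renormalization transformations for lattice
gauge theories. I*, Commun. Math. Phys. **95** (1984) 17–40 [`Balaban1984PropagatorsI`, "B5"], p. 39 [PDF 23]
((1.132)–(1.134)) and pp. 35–36 [PDF 19–20] ((1.108)–(1.114)); held as `paper:balaban1984-cmp95-propagators-rt-i`.

## WHAT IS PRINTED (verbatim, p. 39)

«Properties of the operator G₀ can be easily reduced to the corresponding properties of the operator G′ by the
equality G₀ = G′ + G′(a_kQ′*Q′ − aQ*Q)G₀. (1.133) We only have to know some weak bounds for G₀, for example bounds in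
the L²-norm (1.89), or (1.114).»

## WHAT THIS MODULE PROVES (kernel-checked, zero sorry), and for what

The tree's located leaf `B5Transfer133.Carrier133`/`CarrierFacts`/`Display133` (the USE of (1.133), «its use is not
printed») asks, for a G′-setting and a G₀-setting on one torus, for: cube pieces `piece p J y″` = 1_{Δ(y″)}·V·(G₀^{(p)}J)
with «the sup norm of the cube piece ≤ A·Σ_{w ∈ nbr y″} ‖ζ_wG₀^{(p)}J‖ — Cauchy–Schwarz for the block averages Q, Q′»
(`piece_norm`), their supports (`piece_supp`), and (1.133) entry by entry as sums over y″ (`Display133`).  For the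
concrete pair (`B5GpSettingTorus.gpSetting P a m² k o`, `B5G0SettingTorus.g0Setting P a m² k μ`) this module supplies the
torus-geometric and Cauchy–Schwarz half:
§1 lattice geometry by DISTANCES only: one unit shift moves a point by ≤ 1 (`T_shift_le_one`), t shifts by ≤ t
   (`T_shiftN_le`), every fine point lies in the cube Δ̃ of its own block corner (`inCube_proj`), unit-lattice distances
   from fine distances (`T_proj_proj_lt`);
§2 the indicators 1_{B^k(y″)} (`blockInd`, Σ_{y″} = 1: `sum_blockInd`) and 1_{Δ̃(w)} (`cubeInd`, the cut-offs ζ_w of the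
   carrier, |ζ_w| ≤ 1, supp ⊂ Δ̃(w)), the scalar L²(T_η) norm `l2S` and CAUCHY–SCHWARZ ON A BLOCK: |L^{−kd}Σ_{B(w)}g| ≤
   ‖1_{Δ̃(w)}g‖ (`abs_blockAvg_le`, |B^k(w)| = L^{kd});
§3 the «weak bounds» for the concrete V = a_kQ′*_kQ′_k − aQ*_μQ_μ: |(Q′_kF)(y)| ≤ ‖ζ_yF‖ (`abs_Qk_mulVec_le`),
   |(Q_μF)(y)| ≤ Σ_{|w−y|<3} ‖ζ_wF‖ (`abs_Qv_mulVec_le`: the contour points x′ + tηe_μ, x′ ∈ B(y), t < L^k, lie within 2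
   of y), |(Q*_μQ_μF)(x)| ≤ Σ_{|w−y″|<6} ‖ζ_wF‖ for x ∈ B(y″) (`abs_QvTQv_mulVec_le`: Q*_μ redistributes with the
   non-negative weights L^{kd}Q_μ(y, x) of total mass 1, `Qv_colsum`), hence |(VF)(x)| ≤ (a_k + a)·Σ_{|w−y″|<6} ‖ζ_wF‖ ≤
   2a·Σ (`abs_V_mulVec_le`, a_k ≤ a);
§4 the pieces `pieceFn V F y″ = 1_{B(y″)}·(VF)` with Σ_{y″} pieceFn = VF (`sum_pieceFn`), and (1.133) WITH THE CUBE
   DECOMPOSITION, pointwise: (DG₀E f)(x) = (DG′E f)(x) + Σ_{y″} (DG′ (1_{B(y″)}V G₀E f))(x) for any left factor D (1, ∂_λ, Δ)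
   and right factor E (1, ∂*_ν) (`DG0E_apply_pieces`, from `B5Eq133G0Torus.eq1133`).
HONEST SCOPE: U = 1; tori of `Setup`; levels 1 ≤ k ≤ m + K; constants explicit, not optimised (neighbourhood radius 6).
The carrier instance, `Display133` and the transfer theorem are the next file (`B5Display133G0Torus`).  CELL BOOK-KEEPING:
row B5.Prop1.2 census (vii) of ROWS-B5 (owner r02, referee ref-4); VALUE = located leaves of the tree's (1.133)-transfer
become theorems for Bałaban's operators, NOT summit progress.
-/

namespace Literature.MathematicalPhysics.QuantumFieldTheory.Balaban1983to89

open Matrix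

noncomputable section

namespace B5Pieces133Torus

open B1RG242Torus B5Ineq137Torus B5GpSettingTorus B5Eq133G0Torus B5G0SettingTorus B5Display136Torus
open B4TorusKernel.MultiPeriod (circAbs circAbs_nonneg circAbs_le_abs circAbs_add_mul)

variable {P : Params}

/-! ## §1 Lattice geometry by distances -/

/-- The coordinates of `toT x` are the `val`s (definitional). [folklore] -/
private theorem toT_val {j : ℕ} (x : Site P j) (ν : Fin P.d) : ((toT x) ν).val = (x ν).val := rfl

/-- `T ≤ r` from coordinatewise bounds on the circular distances. [folklore] -/
private theorem T_le_of_ccoord {j : ℕ} (x y : Site P j) {r : ℕ}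
    (h : ∀ ν, circAbs (P.sitesPerDir j) (((x ν).val : ℤ) - ((y ν).val : ℤ)) ≤ r) : T P j x y ≤ r := by
  unfold T B4Sect5Torus.tdist
  have hs : Finset.univ.sup (B4Sect5Torus.ccoord (Nv P j) (toT x) (toT y)) ≤ r := by
    refine Finset.sup_le fun ν _ => ?_
    unfold B4Sect5Torus.ccoord
    exact Int.toNat_le.mpr (h ν)
  exact_mod_cast hs

/-- **One unit shift moves a point of T^{(j)} by at most 1** (exactly 1 unless the torus has one site per direction).
[cite: Balaban1984PropagatorsI, (1.18) p.20 («x(b) = x + e_μ»)] -/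
theorem T_shift_le_one (j : ℕ) (x : Site P j) (μ : Fin P.d) : T P j x (Site.shift x μ) ≤ 1 := by
  have h1 : T P j x (Site.shift x μ) ≤ (1 : ℕ) := by
    refine T_le_of_ccoord x _ fun ν => ?_
    have hN : 1 ≤ P.sitesPerDir j := (P.one_lt_sitesPerDir j).le
    by_cases hν : ν = μ
    · subst hν
      rw [Site.shift, Function.update_self, ZMod.val_add, ZMod.val_one]
      set v := (x ν).val with hv
      set N := P.sitesPerDir j with hNdef
      have hvN : v < N := ZMod.val_lt (x ν)
      by_cases hc : v + 1 < N
      · rw [Nat.mod_eq_of_lt hc]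
        calc circAbs N ((v : ℤ) - ((v + 1 : ℕ) : ℤ)) = circAbs N (-1) := by congr 1; push_cast; ring
          _ ≤ |(-1 : ℤ)| := circAbs_le_abs hN _
          _ = (1 : ℕ) := by norm_num
      · have hv1 : v + 1 = N := by omega
        rw [hv1, Nat.mod_self]
        calc circAbs N ((v : ℤ) - ((0 : ℕ) : ℤ)) = circAbs N (-1 + N * 1) := by
              congr 1; have : (v : ℤ) = N - 1 := by omega
              rw [this]; push_cast; ring
          _ = circAbs N (-1) := circAbs_add_mul N _ _
          _ ≤ |(-1 : ℤ)| := circAbs_le_abs hN _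
          _ = (1 : ℕ) := by norm_num
    · rw [Site.shift, Function.update_of_ne hν, sub_self, B4Sect5Torus.circAbs_zero]
      exact_mod_cast Nat.zero_le 1
  exact_mod_cast h1

/-- **t unit shifts move a point by at most t**: `|x − (x + tηe_μ)| ≤ t` fine steps. [cite: Balaban1984PropagatorsI, (1.18) p.20] -/
theorem T_shiftN_le {j : ℕ} (x : Site P j) (μ : Fin P.d) (t : ℕ) : T P j x (shiftN P x μ t) ≤ t := by
  induction t with
  | zero => rw [shiftN_zero, T_self]; exact_mod_cast le_rfl
  | succ t ih =>
    rw [shiftN_succ]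
    calc T P j x (Site.shift (shiftN P x μ t) μ)
        ≤ T P j x (shiftN P x μ t) + T P j (shiftN P x μ t) (Site.shift (shiftN P x μ t) μ) := T_triangle P j _ _ _
      _ ≤ t + 1 := add_le_add ih (T_shift_le_one j _ μ)
      _ = ((t + 1 : ℕ) : ℝ) := by push_cast; ring

/-- The block map of `B1RG242Torus` is `B5Ineq137Torus.blk` (definitional): x ∈ B^k(y). [cite: Balaban1984PropagatorsI, p.35 (the cubes Δ(y))] -/
theorem proj_eq_blk (k : ℕ) (x : Site P 0) : Site.proj k k x = blk P k x := rfl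

/-- **Every fine point lies in the cube Δ̃ of its own block corner**: x ∈ B^k(y) ⊂ Δ̃(y) (distance ≤ L^k − 1 to the corner).
[cite: Balaban1984PropagatorsI, p.35 (the cubes Δ(y) ⊂ Δ̃(y))] -/
theorem inCube_proj {k : ℕ} (hk : k ≤ P.m + P.K) (x : Site P 0) : inCube P k x (Site.proj k k x) := by
  show T P 0 x (fine P k (blk P k x)) ≤ (P.L : ℝ) ^ k
  have h := T_blk_le P hk x
  linarith

/-- x ∈ B^k(y) ⟹ x ∈ Δ̃(y). [cite: Balaban1984PropagatorsI, p.35 (the cubes Δ(y) ⊂ Δ̃(y))] -/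
theorem inCube_of_proj_eq {k : ℕ} (hk : k ≤ P.m + P.K) {x : Site P 0} {y : Site P k} (h : Site.proj k k x = y) :
    inCube P k x y := h ▸ inCube_proj hk x

/-- **Unit-lattice distances from fine distances**: `|y − y′| < r/L^k + 2` whenever some x ∈ B(y), z ∈ B(y′) have
`|x − z| ≤ r` (fine steps). [cite: Balaban1984PropagatorsI, p.35 (the cubes Δ̃(y))] -/
theorem T_proj_proj_lt {k : ℕ} (hk : k ≤ P.m + P.K) {x z : Site P 0} {r : ℝ} (h : T P 0 x z ≤ r) :
    T P k (Site.proj k k x) (Site.proj k k z) < r / (P.L : ℝ) ^ k + 2 := by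
  have hL : (0 : ℝ) < (P.L : ℝ) ^ k := pow_pos P.cast_L_pos k
  have h1 : T P 0 x (fine P k (blk P k x)) ≤ (P.L : ℝ) ^ k - 1 := T_blk_le P hk x
  have h2 : T P 0 z (fine P k (blk P k z)) ≤ (P.L : ℝ) ^ k - 1 := T_blk_le P hk z
  have t1 : T P 0 (fine P k (blk P k x)) (fine P k (blk P k z)) ≤
      T P 0 (fine P k (blk P k x)) x + T P 0 x (fine P k (blk P k z)) := T_triangle P 0 _ _ _
  have t2 : T P 0 x (fine P k (blk P k z)) ≤ T P 0 x z + T P 0 z (fine P k (blk P k z)) := T_triangle P 0 _ _ _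
  have hs : T P 0 (fine P k (blk P k x)) x = T P 0 x (fine P k (blk P k x)) := T_symm P 0 _ _
  have hff : T P 0 (fine P k (blk P k x)) (fine P k (blk P k z)) = (P.L : ℝ) ^ k * T P k (blk P k x) (blk P k z) :=
    T_fine_fine P hk _ _
  have h3 : (P.L : ℝ) ^ k * T P k (blk P k x) (blk P k z) ≤ (P.L : ℝ) ^ k - 1 + r + ((P.L : ℝ) ^ k - 1) := by
    linarith
  rw [proj_eq_blk, proj_eq_blk, div_add' _ _ _ hL.ne', lt_div_iff₀ hL]
  nlinarith

/-! ## §2 Indicators of blocks and cubes, the scalar L² norm, Cauchy–Schwarz on a block -/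

variable (P) in
/-- **1_{B^k(y″)}(x)**: the indicator of the block (unit cube) of the unit-lattice point y″ — the cube decomposition
«VG₀J = Σ_{y″} 1_{Δ(y″)}VG₀J» of the located leaf. [cite: Balaban1984PropagatorsI, (1.133) p.39, p.35 (the cubes Δ(y))] -/
def blockInd (k : ℕ) (y : Site P k) (x : Site P 0) : ℝ := if Site.proj k k x = y then 1 else 0

/-- Exactly one block contains x: Σ_{y″} 1_{B(y″)}(x) = 1. [cite: Balaban1984PropagatorsI, p.35 (the cubes Δ(y))] -/
theorem sum_blockInd (k : ℕ) (x : Site P 0) : ∑ y : Site P k, blockInd P k y x = 1 := by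
  simp only [blockInd]
  rw [Finset.sum_ite_eq, if_pos (Finset.mem_univ _)]

/-- `0 ≤ 1_{B(y)} ≤ 1`. [folklore] -/
private theorem blockInd_nonneg (k : ℕ) (y : Site P k) (x : Site P 0) : 0 ≤ blockInd P k y x := by
  unfold blockInd; split_ifs <;> norm_num

/-- `1_{B(y)} ≤ 1`. [folklore] -/
private theorem blockInd_le_one (k : ℕ) (y : Site P k) (x : Site P 0) : blockInd P k y x ≤ 1 := by
  unfold blockInd; split_ifs <;> norm_num

variable (P) in
/-- **ζ_w = 1_{Δ̃(w)}**: the indicator cut-off of the cube Δ̃(w) (the `ζ0 w` of the carrier: supp ⊂ Δ̃(w), |ζ_w| ≤ 1).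
[cite: Balaban1984PropagatorsI, (1.114) p.36 («ζ ∈ C₀^∞(Δ̃(y))»)] -/
def cubeInd (k : ℕ) (w : Site P k) (x : Site P 0) : ℝ := if inCube P k x w then 1 else 0

/-- supp ζ_w ⊂ Δ̃(w). [cite: Balaban1984PropagatorsI, (1.114) p.36] -/
theorem cubeInd_ne_zero {k : ℕ} {w : Site P k} {x : Site P 0} (h : cubeInd P k w x ≠ 0) : inCube P k x w := by
  unfold cubeInd at h
  by_contra hx
  exact h (if_neg hx)

/-- `|ζ_w| ≤ 1`, indeed `sup |ζ_w| ≤ 1`. [cite: Balaban1984PropagatorsI, (1.114) p.36] -/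
theorem supN_cubeInd_le (k : ℕ) (w : Site P k) : supN P (cubeInd P k w) ≤ 1 := by
  refine Finset.sup'_le _ _ fun x _ => ?_
  unfold cubeInd
  split_ifs <;> norm_num

/-- ζ_w = 1 on the block B(w) ⊂ Δ̃(w). [cite: Balaban1984PropagatorsI, p.35 (the cubes)] -/
theorem cubeInd_of_proj_eq {k : ℕ} (hk : k ≤ P.m + P.K) {w : Site P k} {x : Site P 0} (h : Site.proj k k x = w) :
    cubeInd P k w x = 1 := if_pos (inCube_of_proj_eq hk h)

variable (P) in
/-- **The L²(T_η) norm of a scalar function**: ‖g‖ = (Σ_x η^d g(x)²)^{1/2}, η = L^{−k}. [cite: Balaban1984PropagatorsI, (1.89) p.33] -/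
def l2S (k : ℕ) (g : Site P 0 → ℝ) : ℝ := Real.sqrt (∑ x, (((P.L : ℝ) ^ k)⁻¹) ^ P.d * g x ^ 2)

/-- `0 ≤ ‖g‖`. [cite: Balaban1984PropagatorsI, (1.89) p.33] -/
theorem l2S_nonneg (k : ℕ) (g : Site P 0 → ℝ) : 0 ≤ l2S P k g := Real.sqrt_nonneg _

/-- A member of a family is bounded by the family norm: ‖F_i‖ ≤ ‖F‖. [cite: Balaban1984PropagatorsI, (1.89) p.33] -/
theorem l2S_le_l2Fam (k : ℕ) {ι : Type} [Fintype ι] (F : ι → Site P 0 → ℝ) (i : ι) : l2S P k (F i) ≤ l2Fam P k F := by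
  unfold l2S l2Fam
  apply Real.sqrt_le_sqrt
  have h := Finset.single_le_sum (f := fun i => ∑ x, (((P.L : ℝ) ^ k)⁻¹) ^ P.d * F i x ^ 2)
    (fun i _ => Finset.sum_nonneg fun x _ => by positivity) (Finset.mem_univ i)
  exact h

/-- **CAUCHY–SCHWARZ ON A BLOCK**: |L^{−kd}Σ_{x∈B(w)} g(x)| ≤ ‖ζ_w·g‖_{L²(T_η)} (|B^k(w)| = L^{kd}, B(w) ⊂ Δ̃(w)) — the
«Cauchy–Schwarz for the block averages» of the located leaf. [cite: Balaban1984PropagatorsI, (1.133) p.39 («weak bounds …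
in the L²-norm»)] -/
theorem abs_blockAvg_le {k : ℕ} (hk : k ≤ P.m + P.K) (w : Site P k) (g : Site P 0 → ℝ) :
    |(((P.L : ℝ) ^ P.d)⁻¹) ^ k * ∑ x ∈ Finset.univ.filter (fun x : Site P 0 => Site.proj k k x = w), g x| ≤
      l2S P k (fun x => cubeInd P k w x * g x) := by
  set B := Finset.univ.filter (fun x : Site P 0 => Site.proj k k x = w) with hB
  have hLk : (0 : ℝ) < (P.L : ℝ) ^ k := pow_pos P.cast_L_pos k
  have hcard : (B.card : ℝ) = ((P.L : ℝ) ^ k) ^ P.d := by rw [hB, card_Bj hk w]; push_cast; ring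
  -- Cauchy–Schwarz: (Σ_B g)² ≤ |B| Σ_B g²
  have hCS : (∑ x ∈ B, g x) ^ 2 ≤ (B.card : ℝ) * ∑ x ∈ B, g x ^ 2 := by
    have h := Finset.sum_mul_sq_le_sq_mul_sq B (fun _ => (1 : ℝ)) g
    simp only [one_mul, one_pow, Finset.sum_const, nsmul_eq_mul, mul_one] at h
    exact h
  -- Σ_B g² ≤ Σ_x (ζ_w g)²
  have hsub : ∑ x ∈ B, g x ^ 2 ≤ ∑ x, (cubeInd P k w x * g x) ^ 2 := by
    calc ∑ x ∈ B, g x ^ 2 = ∑ x ∈ B, (cubeInd P k w x * g x) ^ 2 := by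
          refine Finset.sum_congr rfl fun x hx => ?_
          rw [cubeInd_of_proj_eq hk (Finset.mem_filter.mp hx).2, one_mul]
      _ ≤ ∑ x, (cubeInd P k w x * g x) ^ 2 :=
          Finset.sum_le_sum_of_subset_of_nonneg (Finset.subset_univ _) fun x _ _ => sq_nonneg _
  have hw : (((P.L : ℝ) ^ P.d)⁻¹) ^ k = (((P.L : ℝ) ^ k) ^ P.d)⁻¹ := by
    rw [inv_pow, ← pow_mul, ← pow_mul, mul_comm]
  have hBpos : (0 : ℝ) < B.card := by rw [hcard]; positivity
  rw [hw, l2S, ← Finset.mul_sum, inv_pow ((P.L : ℝ) ^ k) P.d, ← hcard, abs_mul, abs_inv, abs_of_pos hBpos,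
    Real.le_sqrt (by positivity), mul_pow, sq_abs]
  calc ((B.card : ℝ)⁻¹) ^ 2 * (∑ x ∈ B, g x) ^ 2 ≤ ((B.card : ℝ)⁻¹) ^ 2 * ((B.card : ℝ) * ∑ x ∈ B, g x ^ 2) :=
        mul_le_mul_of_nonneg_left hCS (by positivity)
    _ = (B.card : ℝ)⁻¹ * ∑ x ∈ B, g x ^ 2 := by field_simp
    _ ≤ (B.card : ℝ)⁻¹ * ∑ x, (cubeInd P k w x * g x) ^ 2 := mul_le_mul_of_nonneg_left hsub (by positivity)
  · exact mul_nonneg (inv_nonneg.mpr hBpos.le) (Finset.sum_nonneg fun x _ => sq_nonneg _)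

/-- `‖ζ|g|‖ = ‖ζg‖`. [folklore] -/
private theorem l2S_cut_abs (k : ℕ) (ζ g : Site P 0 → ℝ) :
    l2S P k (fun x => ζ x * |g x|) = l2S P k (fun x => ζ x * g x) := by
  unfold l2S
  congr 1
  refine Finset.sum_congr rfl fun x _ => ?_
  rw [mul_pow, mul_pow, sq_abs]

variable (P) in
/-- Shorthand: the localized L² norm ‖ζ_w·F‖ with the cube indicator ζ_w = 1_{Δ̃(w)}. [cite: Balaban1984PropagatorsI, (1.114) p.36] -/
def nz (k : ℕ) (w : Site P k) (F : Site P 0 → ℝ) : ℝ := l2S P k (fun x => cubeInd P k w x * F x)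

/-- `0 ≤ ‖ζ_wF‖`. [cite: Balaban1984PropagatorsI, (1.114) p.36] -/
theorem nz_nonneg (k : ℕ) (w : Site P k) (F : Site P 0 → ℝ) : 0 ≤ nz P k w F := l2S_nonneg k _

/-- **Σ_{B(w)} |F| ≤ L^{kd}·‖ζ_wF‖** (Cauchy–Schwarz on the block, |B(w)| = L^{kd}). [cite: Balaban1984PropagatorsI, (1.133) p.39 («weak bounds … L²»)] -/
theorem sum_block_abs_le {k : ℕ} (hk : k ≤ P.m + P.K) (w : Site P k) (F : Site P 0 → ℝ) :
    ∑ z ∈ Finset.univ.filter (fun z : Site P 0 => Site.proj k k z = w), |F z| ≤ ((P.L : ℝ) ^ k) ^ P.d * nz P k w F := by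
  have h := abs_blockAvg_le hk w (fun z => |F z|)
  have hc : (0 : ℝ) < (((P.L : ℝ) ^ P.d)⁻¹) ^ k := pow_pos (inv_pos.mpr (pow_pos P.cast_L_pos _)) _
  rw [abs_mul, abs_of_pos hc, abs_of_nonneg (Finset.sum_nonneg fun z _ => abs_nonneg _), l2S_cut_abs] at h
  have hinv : ((((P.L : ℝ) ^ P.d)⁻¹) ^ k)⁻¹ = ((P.L : ℝ) ^ k) ^ P.d := by
    rw [inv_pow, inv_inv, ← pow_mul, ← pow_mul, mul_comm]
  calc ∑ z ∈ Finset.univ.filter (fun z : Site P 0 => Site.proj k k z = w), |F z|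
      = ((((P.L : ℝ) ^ P.d)⁻¹) ^ k)⁻¹ * ((((P.L : ℝ) ^ P.d)⁻¹) ^ k *
          ∑ z ∈ Finset.univ.filter (fun z : Site P 0 => Site.proj k k z = w), |F z|) := by
        rw [← mul_assoc, inv_mul_cancel₀ hc.ne', one_mul]
    _ ≤ ((((P.L : ℝ) ^ P.d)⁻¹) ^ k)⁻¹ * nz P k w F := mul_le_mul_of_nonneg_left h (inv_nonneg.mpr hc.le)
    _ = ((P.L : ℝ) ^ k) ^ P.d * nz P k w F := by rw [hinv]

/-! ## §3 The «weak bounds»: Q′_k, Q_μ, Q*_μQ_μ and V against localized L² norms -/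

/-- **|(Q′_kF)(y)| ≤ ‖ζ_yF‖** (the block average against the localized L² norm). [cite: Balaban1984PropagatorsI, (1.133) p.39] -/
theorem abs_Qk_mulVec_le {k : ℕ} (hk : k ≤ P.m + P.K) (F : Site P 0 → ℝ) (y : Site P k) :
    |(Qk P k *ᵥ F) y| ≤ nz P k y F := by
  rw [Qk_mulVec' hk]
  exact abs_blockAvg_le hk y F

/-- Entries of the powers of the shift matrix: `(S_μ^t)(x, x′) = [x′ = x + tηe_μ]`. [cite: Balaban1984PropagatorsI, (1.18) p.20] -/
private theorem shiftMat_pow_apply (μ : Fin P.d) (t : ℕ) (x x' : Site P 0) :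
    (shiftMat P 0 μ ^ t) x x' = if x' = shiftN P x μ t then 1 else 0 := by
  have h := shiftMat_pow_mulVec μ t (fun z => if x' = z then (1 : ℝ) else 0) x
  simp only [Matrix.mulVec, dotProduct, mul_ite, mul_one, mul_zero, Finset.sum_ite_eq, Finset.mem_univ,
    if_true] at h
  exact h

/-- Entries of the contour matrix: `lineMat(x, x′) = #{t < n : x′ = x + tηe_μ}`. [cite: Balaban1984PropagatorsI, (1.18) p.20] -/
private theorem lineMat_apply (n : ℕ) (μ : Fin P.d) (x x' : Site P 0) :
    lineMat P n μ x x' = ∑ t ∈ Finset.range n, (if x' = shiftN P x μ t then (1 : ℝ) else 0) := by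
  simp only [lineMat, Matrix.sum_apply, shiftMat_pow_apply]

/-- Entries of Q′_k (`avgMat`, definitional). [cite: Balaban1984PropagatorsI, (1.20) p.20] -/
private theorem Qk_apply_eq (k : ℕ) (y : Site P k) (x' : Site P 0) :
    Qk P k y x' = if Site.proj k (lvl P k) x' = y then (((P.L : ℝ) ^ P.d)⁻¹) ^ lvl P k else 0 := rfl

/-- Entries of Q_μ from its factorisation η·(Q′_k ∘ lineMat). [cite: Balaban1984PropagatorsI, (1.18) p.20] -/
private theorem Qv_apply (k : ℕ) (μ : Fin P.d) (y : Site P k) (x : Site P 0) :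
    Qv P k μ y x = ((P.L : ℝ) ^ lvl P k)⁻¹ * ∑ x', Qk P k y x' * lineMat P (P.L ^ lvl P k) μ x' x := by
  rw [Qv, Matrix.smul_apply, smul_eq_mul, Matrix.mul_apply]

/-- **The entries of Q_μ are non-negative** (weights η^{d+1} times counts). [cite: Balaban1984PropagatorsI, (1.18) p.20] -/
theorem Qv_nonneg (k : ℕ) (μ : Fin P.d) (y : Site P k) (x : Site P 0) : 0 ≤ Qv P k μ y x := by
  rw [Qv_apply]
  refine mul_nonneg (inv_nonneg.mpr (pow_nonneg P.cast_L_pos.le _)) (Finset.sum_nonneg fun x' _ => mul_nonneg ?_ ?_)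
  · rw [Qk_apply_eq]
    split_ifs
    · exact pow_nonneg (inv_nonneg.mpr (pow_nonneg P.cast_L_pos.le _)) _
    · exact le_rfl
  · rw [lineMat_apply]
    exact Finset.sum_nonneg fun t _ => by split_ifs <;> norm_num

/-- **Support of Q_μ**: `Q_μ(y, x) ≠ 0` only if x = x′ + tηe_μ for some x′ ∈ B^k(y) and t < L^k (x lies on a contour from B(y)).
[cite: Balaban1984PropagatorsI, (1.18) p.20] -/
theorem Qv_apply_ne_zero {k : ℕ} (hk : k ≤ P.m + P.K) {μ : Fin P.d} {y : Site P k} {x : Site P 0}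
    (h : Qv P k μ y x ≠ 0) : ∃ x' : Site P 0, Site.proj k k x' = y ∧ ∃ t, t < P.L ^ k ∧ shiftN P x' μ t = x := by
  rw [Qv_apply, lvl_of_le P hk] at h
  obtain ⟨x', -, hx'⟩ := Finset.exists_ne_zero_of_sum_ne_zero (mul_ne_zero_iff.mp h).2
  obtain ⟨hq, hl⟩ := mul_ne_zero_iff.mp hx'
  refine ⟨x', ?_, ?_⟩
  · rw [Qk_apply_eq, lvl_of_le P hk] at hq
    by_contra hne
    exact hq (if_neg hne)
  · rw [lineMat_apply] at hl
    obtain ⟨t, ht, hne⟩ := Finset.exists_ne_zero_of_sum_ne_zero hl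
    refine ⟨t, Finset.mem_range.mp ht, ?_⟩
    by_contra hx
    exact hne (if_neg fun h' => hx h'.symm)

variable (P) in
/-- The unit-lattice neighbourhood `{w : |y − w| < r}` (sup torus distance on T₁^{(k)}). [cite: Balaban1984PropagatorsI, p.35] -/
def nbhd (k : ℕ) (y : Site P k) (r : ℝ) : Finset (Site P k) := Finset.univ.filter fun w => T P k y w < r

/-- Membership in the neighbourhood of the unit lattice. [cite: Balaban1984PropagatorsI, p.35] -/
theorem mem_nbhd {k : ℕ} {y w : Site P k} {r : ℝ} : w ∈ nbhd P k y r ↔ T P k y w < r := by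
  simp [nbhd]

/-- A point of a contour from B(y) lies in a block B(w) with |y − w| < 3. [cite: Balaban1984PropagatorsI, (1.18) p.20] -/
private theorem T_lt_three {k : ℕ} (hk : k ≤ P.m + P.K) {μ : Fin P.d} {y : Site P k} {x' : Site P 0}
    (hx' : Site.proj k k x' = y) {t : ℕ} (ht : t < P.L ^ k) :
    T P k y (Site.proj k k (shiftN P x' μ t)) < 3 := by
  have hL : (0 : ℝ) < (P.L : ℝ) ^ k := pow_pos P.cast_L_pos k
  have h1 : T P 0 x' (shiftN P x' μ t) ≤ (P.L : ℝ) ^ k - 1 := by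
    have := T_shiftN_le x' μ t
    have ht' : (t : ℝ) ≤ (P.L : ℝ) ^ k - 1 := by
      have : (t : ℝ) + 1 ≤ (P.L : ℝ) ^ k := by exact_mod_cast ht
      linarith
    exact this.trans ht'
  have h2 := T_proj_proj_lt hk (x := x') (z := shiftN P x' μ t) h1
  rw [hx'] at h2
  have h3 : ((P.L : ℝ) ^ k - 1) / (P.L : ℝ) ^ k + 2 ≤ 3 := by
    rw [div_add' _ _ _ hL.ne', div_le_iff₀ hL]; nlinarith
  exact lt_of_lt_of_le h2 h3

/-- Points of the contours from B(y): Σ_{x′∈B(y)} |F(x′ + tηe_μ)| ≤ Σ_{|w−y|<3} L^{kd}‖ζ_wF‖ (the translation is a bijection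
of the torus; each image point lies in a block within 2 of y; Cauchy–Schwarz per block). [cite: Balaban1984PropagatorsI, (1.18) p.20, (1.133) p.39] -/
private theorem sum_abs_shift_le {k : ℕ} (hk : k ≤ P.m + P.K) (μ : Fin P.d) (y : Site P k) {t : ℕ} (ht : t < P.L ^ k)
    (F : Site P 0 → ℝ) :
    ∑ x' ∈ Finset.univ.filter (fun x' : Site P 0 => Site.proj k k x' = y), |F (shiftN P x' μ t)| ≤
      ∑ w ∈ nbhd P k y 3, ((P.L : ℝ) ^ k) ^ P.d * nz P k w F := by
  classical
  set B := Finset.univ.filter (fun x' : Site P 0 => Site.proj k k x' = y) with hB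
  -- insert Σ_w 1_{B(w)} = 1 and exchange
  have step1 : ∑ x' ∈ B, |F (shiftN P x' μ t)| =
      ∑ w : Site P k, ∑ x' ∈ B, blockInd P k w (shiftN P x' μ t) * |F (shiftN P x' μ t)| := by
    rw [Finset.sum_comm]
    refine Finset.sum_congr rfl fun x' _ => ?_
    rw [← Finset.sum_mul, sum_blockInd, one_mul]
  -- only the blocks w with |y − w| < 3 contribute
  have step2 : ∑ w : Site P k, ∑ x' ∈ B, blockInd P k w (shiftN P x' μ t) * |F (shiftN P x' μ t)| =
      ∑ w ∈ nbhd P k y 3, ∑ x' ∈ B, blockInd P k w (shiftN P x' μ t) * |F (shiftN P x' μ t)| := by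
    symm
    refine Finset.sum_subset (Finset.subset_univ _) fun w _ hw => ?_
    refine Finset.sum_eq_zero fun x' hx' => ?_
    have hproj : Site.proj k k (shiftN P x' μ t) ≠ w := by
      intro hc
      apply hw
      rw [mem_nbhd, ← hc]
      exact T_lt_three hk (Finset.mem_filter.mp hx').2 ht
    rw [blockInd, if_neg hproj, zero_mul]
  -- drop the restriction x′ ∈ B(y), use the bijection x′ ↦ x′ + tηe_μ, and Cauchy–Schwarz on B(w)
  have step3 : ∀ w : Site P k, ∑ x' ∈ B, blockInd P k w (shiftN P x' μ t) * |F (shiftN P x' μ t)| ≤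
      ((P.L : ℝ) ^ k) ^ P.d * nz P k w F := by
    intro w
    calc ∑ x' ∈ B, blockInd P k w (shiftN P x' μ t) * |F (shiftN P x' μ t)|
        ≤ ∑ x' : Site P 0, blockInd P k w (shiftN P x' μ t) * |F (shiftN P x' μ t)| :=
          Finset.sum_le_sum_of_subset_of_nonneg (Finset.subset_univ _)
            fun x' _ _ => mul_nonneg (blockInd_nonneg k w _) (abs_nonneg _)
      _ = ∑ z : Site P 0, blockInd P k w z * |F z| := sum_shiftN μ t (fun z => blockInd P k w z * |F z|)
      _ = ∑ z ∈ Finset.univ.filter (fun z : Site P 0 => Site.proj k k z = w), |F z| := by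
          rw [Finset.sum_filter]
          refine Finset.sum_congr rfl fun z _ => ?_
          unfold blockInd
          split_ifs <;> simp
      _ ≤ ((P.L : ℝ) ^ k) ^ P.d * nz P k w F := sum_block_abs_le hk w F
  rw [step1, step2]
  exact Finset.sum_le_sum fun w _ => step3 w

/-- **|(Q_μF)(y)| ≤ Σ_{|w−y|<3} ‖ζ_wF‖**: the vector block average (1.18) of a scalar component against the localized L²
norms of the blocks within 2 of y. [cite: Balaban1984PropagatorsI, (1.18) p.20, (1.133) p.39 («weak bounds … L²»)] -/
theorem abs_Qv_mulVec_le {k : ℕ} (hk : k ≤ P.m + P.K) (μ : Fin P.d) (F : Site P 0 → ℝ) (y : Site P k) :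
    |(Qv P k μ *ᵥ F) y| ≤ ∑ w ∈ nbhd P k y 3, nz P k w F := by
  have hL : (0 : ℝ) < (P.L : ℝ) ^ k := pow_pos P.cast_L_pos k
  set B := Finset.univ.filter (fun x' : Site P 0 => Site.proj k k x' = y) with hB
  set S := ∑ w ∈ nbhd P k y 3, nz P k w F with hS
  rw [Qv_mulVec hk]
  have hc : 0 ≤ (((P.L : ℝ) ^ k)⁻¹) ^ (P.d + 1) := pow_nonneg (inv_nonneg.mpr hL.le) _
  have h1 : |∑ x' ∈ B, ∑ t ∈ Finset.range (P.L ^ k), F (shiftN P x' μ t)| ≤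
      ∑ t ∈ Finset.range (P.L ^ k), ∑ x' ∈ B, |F (shiftN P x' μ t)| := by
    calc |∑ x' ∈ B, ∑ t ∈ Finset.range (P.L ^ k), F (shiftN P x' μ t)|
        ≤ ∑ x' ∈ B, |∑ t ∈ Finset.range (P.L ^ k), F (shiftN P x' μ t)| := Finset.abs_sum_le_sum_abs _ _
      _ ≤ ∑ x' ∈ B, ∑ t ∈ Finset.range (P.L ^ k), |F (shiftN P x' μ t)| :=
          Finset.sum_le_sum fun x' _ => Finset.abs_sum_le_sum_abs _ _
      _ = _ := Finset.sum_comm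
  have h2 : ∑ t ∈ Finset.range (P.L ^ k), ∑ x' ∈ B, |F (shiftN P x' μ t)| ≤
      ∑ t ∈ Finset.range (P.L ^ k), ((P.L : ℝ) ^ k) ^ P.d * S := by
    refine Finset.sum_le_sum fun t ht => ?_
    rw [hS, Finset.mul_sum]
    exact sum_abs_shift_le hk μ y (Finset.mem_range.mp ht) F
  rw [Finset.sum_const, Finset.card_range, nsmul_eq_mul, Nat.cast_pow] at h2
  rw [abs_mul, abs_of_nonneg hc]
  calc (((P.L : ℝ) ^ k)⁻¹) ^ (P.d + 1) * |∑ x' ∈ B, ∑ t ∈ Finset.range (P.L ^ k), F (shiftN P x' μ t)|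
      ≤ (((P.L : ℝ) ^ k)⁻¹) ^ (P.d + 1) * ((P.L : ℝ) ^ k * (((P.L : ℝ) ^ k) ^ P.d * S)) :=
        mul_le_mul_of_nonneg_left (h1.trans h2) hc
    _ = S := by
        rw [pow_succ, inv_pow]
        field_simp

/-- `Q*_μ` verbatim at entries: `(Q*_μ g)(x) = L^{kd} Σ_y Q_μ(y, x) g(y)`. [cite: Balaban1984PropagatorsI, (1.132) p.39] -/
private theorem QvT_mulVec_apply {k : ℕ} (hk : k ≤ P.m + P.K) (μ : Fin P.d) (g : Site P k → ℝ) (x : Site P 0) :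
    (QvT P k μ *ᵥ g) x = ∑ y, (((P.L : ℝ) ^ P.d) ^ k * Qv P k μ y x) * g y := by
  rw [QvT, Matrix.smul_mulVec, Pi.smul_apply, smul_eq_mul, lvl_of_le P hk]
  simp only [Matrix.mulVec, dotProduct, Matrix.transpose_apply, Finset.mul_sum, mul_assoc]

/-- **|(Q*_μQ_μF)(x)| ≤ Σ_{|w−y″|<6} ‖ζ_wF‖ for x ∈ B(y″)**: Q*_μ redistributes (Q_μF)(y) over the fine points with the
non-negative weights L^{kd}Q_μ(y, x) of total mass 1 (`Qv_colsum`), and only the y within 2 of y″ see x.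
[cite: Balaban1984PropagatorsI, (1.133) p.39 («weak bounds … L²»)] -/
theorem abs_QvTQv_mulVec_le {k : ℕ} (hk : k ≤ P.m + P.K) (μ : Fin P.d) (F : Site P 0 → ℝ) {x : Site P 0}
    {y'' : Site P k} (hx : Site.proj k k x = y'') :
    |((QvT P k μ * Qv P k μ) *ᵥ F) x| ≤ ∑ w ∈ nbhd P k y'' 6, nz P k w F := by
  have hL : (0 : ℝ) < (P.L : ℝ) ^ k := pow_pos P.cast_L_pos k
  set S := ∑ w ∈ nbhd P k y'' 6, nz P k w F with hS
  have hS0 : 0 ≤ S := Finset.sum_nonneg fun w _ => nz_nonneg k w F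
  rw [← Matrix.mulVec_mulVec, QvT_mulVec_apply hk]
  -- each y: weight · |(Q_μF)(y)| ≤ weight · S
  have hterm : ∀ y : Site P k, |(((P.L : ℝ) ^ P.d) ^ k * Qv P k μ y x) * (Qv P k μ *ᵥ F) y| ≤
      (((P.L : ℝ) ^ P.d) ^ k * Qv P k μ y x) * S := by
    intro y
    by_cases hq : Qv P k μ y x = 0
    · rw [hq, mul_zero, zero_mul, zero_mul, abs_zero]
    have hw : 0 ≤ ((P.L : ℝ) ^ P.d) ^ k * Qv P k μ y x :=
      mul_nonneg (pow_nonneg (pow_nonneg P.cast_L_pos.le _) _) (Qv_nonneg k μ y x)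
    rw [abs_mul, abs_of_nonneg hw]
    refine mul_le_mul_of_nonneg_left ?_ hw
    obtain ⟨x', hx', t, ht, hxt⟩ := Qv_apply_ne_zero hk hq
    have hy : T P k y y'' < 3 := by
      have := T_lt_three hk (μ := μ) hx' ht
      rwa [hxt, hx] at this
    calc |(Qv P k μ *ᵥ F) y| ≤ ∑ w ∈ nbhd P k y 3, nz P k w F := abs_Qv_mulVec_le hk μ F y
      _ ≤ S := by
        refine Finset.sum_le_sum_of_subset_of_nonneg ?_ fun w _ _ => nz_nonneg k w F
        intro w hw
        rw [mem_nbhd] at hw ⊢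
        have := T_triangle P k y'' y w
        rw [T_symm P k y'' y] at this
        linarith
  calc |∑ y, (((P.L : ℝ) ^ P.d) ^ k * Qv P k μ y x) * (Qv P k μ *ᵥ F) y|
      ≤ ∑ y, |(((P.L : ℝ) ^ P.d) ^ k * Qv P k μ y x) * (Qv P k μ *ᵥ F) y| := Finset.abs_sum_le_sum_abs _ _
    _ ≤ ∑ y, (((P.L : ℝ) ^ P.d) ^ k * Qv P k μ y x) * S := Finset.sum_le_sum fun y _ => hterm y
    _ = (((P.L : ℝ) ^ P.d) ^ k * ∑ y, Qv P k μ y x) * S := by rw [← Finset.sum_mul, ← Finset.mul_sum]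
    _ = S := by
        rw [Qv_colsum hk, inv_pow, ← pow_mul, ← pow_mul, mul_comm P.d k, mul_inv_cancel₀ (pow_ne_zero _ P.cast_L_pos.ne'),
          one_mul]

/-- `Q′*_k` verbatim at the tree's name `Qks P k` (`B1RG242Torus.Qks_mulVec`). [cite: Balaban1984PropagatorsI, (1.20) p.20] -/
theorem Qks_mulVec' {k : ℕ} (hk : k ≤ P.m + P.K) (g : Site P k → ℝ) (x : Site P 0) :
    (Qks P k *ᵥ g) x = g (Site.proj k k x) :=
  Qks_mulVec 0 0 hk g x

/-- The sum over a neighbourhood dominates each of its (non-negative) terms; y″ ∈ nbhd(y″, r) for r > 0. [cite: Balaban1984PropagatorsI, (1.114) p.36] -/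
theorem nz_le_sum_nbhd {k : ℕ} (y'' : Site P k) {r : ℝ} (hr : 0 < r) (F : Site P 0 → ℝ) :
    nz P k y'' F ≤ ∑ w ∈ nbhd P k y'' r, nz P k w F := by
  have hmem : y'' ∈ nbhd P k y'' r := by rw [mem_nbhd, T_self]; exact hr
  exact Finset.single_le_sum (f := fun w => nz P k w F) (fun w _ => nz_nonneg k w F) hmem

/-- **THE «WEAK BOUNDS» LEAF for V = a_kQ′*_kQ′_k − aQ*_μQ_μ**: for x ∈ B(y″), |(VF)(x)| ≤ 2a·Σ_{|w−y″|<6} ‖ζ_wF‖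
(a_k ≤ a, [2] (2.15)). [cite: Balaban1984PropagatorsI, (1.133) p.39 («weak bounds for G₀ … in the L²-norm»)] -/
theorem abs_V_mulVec_le {a : ℝ} (ha : 0 < a) {k : ℕ} (hk1 : 1 ≤ k) (hk : k ≤ P.m + P.K) (μ : Fin P.d)
    (F : Site P 0 → ℝ) {x : Site P 0} {y'' : Site P k} (hx : Site.proj k k x = y'') :
    |(V P a k μ *ᵥ F) x| ≤ 2 * a * ∑ w ∈ nbhd P k y'' 6, nz P k w F := by
  set S := ∑ w ∈ nbhd P k y'' 6, nz P k w F with hS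
  have hak : B1.aSeq a P.L k ≤ a := B1.aSeq_le ha (one_lt_cast_L P) k hk1
  have hak0 : 0 ≤ B1.aSeq a P.L k := (B1.aSeq_pos ha (one_lt_cast_L P) hk1).le
  have hS0 : 0 ≤ S := Finset.sum_nonneg fun w _ => nz_nonneg k w F
  have h1 : |(Qk P k *ᵥ F) y''| ≤ S := (abs_Qk_mulVec_le hk F y'').trans (nz_le_sum_nbhd y'' (by norm_num) F)
  have h2 : |((QvT P k μ * Qv P k μ) *ᵥ F) x| ≤ S := abs_QvTQv_mulVec_le hk μ F hx
  rw [V, Matrix.sub_mulVec, Matrix.smul_mulVec, Matrix.smul_mulVec, Pi.sub_apply, Pi.smul_apply, Pi.smul_apply,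
    smul_eq_mul, smul_eq_mul, ← Matrix.mulVec_mulVec F (Qks P k) (Qk P k), Qks_mulVec' hk, hx]
  calc |B1.aSeq a P.L k * (Qk P k *ᵥ F) y'' - a * ((QvT P k μ * Qv P k μ) *ᵥ F) x|
      ≤ |B1.aSeq a P.L k * (Qk P k *ᵥ F) y''| + |a * ((QvT P k μ * Qv P k μ) *ᵥ F) x| := abs_sub _ _
    _ = B1.aSeq a P.L k * |(Qk P k *ᵥ F) y''| + a * |((QvT P k μ * Qv P k μ) *ᵥ F) x| := by
        rw [abs_mul, abs_mul, abs_of_nonneg hak0, abs_of_pos ha]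
    _ ≤ a * S + a * S := add_le_add (mul_le_mul hak h1 (abs_nonneg _) ha.le) (mul_le_mul_of_nonneg_left h2 ha.le)
    _ = 2 * a * S := by ring

/-! ## §4 The cube pieces and (1.133) with the cube decomposition -/

variable (P) in
/-- **The cube piece at y″**: `1_{B(y″)}·(V F)` — the located leaf's «1_{Δ(y″)}VG₀J» for one scalar component F of G₀^{(p)}J.
[cite: Balaban1984PropagatorsI, (1.133) p.39] -/
def pieceFn (k : ℕ) (V : Matrix (Site P 0) (Site P 0) ℝ) (F : Site P 0 → ℝ) (y'' : Site P k) : Site P 0 → ℝ :=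
  fun x => blockInd P k y'' x * (V *ᵥ F) x

/-- **The cube decomposition**: Σ_{y″∈T₁} 1_{B(y″)}VF = VF. [cite: Balaban1984PropagatorsI, (1.133) p.39] -/
theorem sum_pieceFn (k : ℕ) (V : Matrix (Site P 0) (Site P 0) ℝ) (F : Site P 0 → ℝ) :
    ∑ y'' : Site P k, pieceFn P k V F y'' = V *ᵥ F := by
  funext x
  rw [Finset.sum_apply]
  simp only [pieceFn]
  rw [← Finset.sum_mul, sum_blockInd, one_mul]

/-- supp (piece at y″) ⊂ B(y″). [cite: Balaban1984PropagatorsI, (1.133) p.39] -/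
theorem proj_eq_of_pieceFn_ne_zero {k : ℕ} {V : Matrix (Site P 0) (Site P 0) ℝ} {F : Site P 0 → ℝ} {y'' : Site P k}
    {x : Site P 0} (h : pieceFn P k V F y'' x ≠ 0) : Site.proj k k x = y'' := by
  by_contra hne
  apply h
  rw [pieceFn, blockInd, if_neg hne, zero_mul]

/-- **The sup bound of a piece** (every point): |1_{B(y″)}(VF)(x)| ≤ 2a·Σ_{|w−y″|<6} ‖ζ_wF‖. [cite: Balaban1984PropagatorsI, (1.133) p.39] -/
theorem abs_pieceFn_le {a : ℝ} (ha : 0 < a) {k : ℕ} (hk1 : 1 ≤ k) (hk : k ≤ P.m + P.K) (μ : Fin P.d)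
    (F : Site P 0 → ℝ) (y'' : Site P k) (x : Site P 0) :
    |pieceFn P k (V P a k μ) F y'' x| ≤ 2 * a * ∑ w ∈ nbhd P k y'' 6, nz P k w F := by
  by_cases hp : Site.proj k k x = y''
  · rw [pieceFn, blockInd, if_pos hp, one_mul]
    exact abs_V_mulVec_le ha hk1 hk μ F hp
  · rw [pieceFn, blockInd, if_neg hp, zero_mul, abs_zero]
    exact mul_nonneg (mul_nonneg (by norm_num) ha.le) (Finset.sum_nonneg fun w _ => nz_nonneg k w F)

section Identity

variable {a msq : ℝ} (ha : 0 < a) (hm : 0 ≤ msq) {k : ℕ} (hk1 : 1 ≤ k) (hk : k ≤ P.m + P.K) (μ : Fin P.d)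
include ha hm hk1 hk

/-- (1.133) composed on both sides: `D·G₀·E = D·G′·E + (D·G′)·V·(G₀·E)`. [cite: Balaban1984PropagatorsI, (1.133) p.39] -/
theorem DG0E_eq (D E : Matrix (Site P 0) (Site P 0) ℝ) :
    D * G0 P a msq k μ * E = D * Grs P a msq k * E + D * Grs P a msq k * (V P a k μ * (G0 P a msq k μ * E)) := by
  conv_lhs => rw [eq1133 ha hm hk1 hk μ]
  simp only [Matrix.mul_add, Matrix.add_mul, Matrix.mul_assoc]

/-- **(1.133) WITH THE CUBE DECOMPOSITION, pointwise**: `(DG₀Ef)(x) = (DG′Ef)(x) + Σ_{y″} (DG′·1_{B(y″)}V(G₀Ef))(x)` for any left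
factor D (1, ∂_λ, Δ) and right factor E (1, ∂*_ν) — the entrywise form G₀J = G′J + Σ_{y″}G′(piece), ∇G₀J = ∇G′J + Σ∇G′(piece),
G₀∇*J = G′∇*J + ΣG′(piece′), … of the located leaf `B5Transfer133.Display133`. [cite: Balaban1984PropagatorsI, (1.133) p.39] -/
theorem DG0E_apply_pieces (D E : Matrix (Site P 0) (Site P 0) ℝ) (f : Site P 0 → ℝ) (x : Site P 0) :
    ((D * G0 P a msq k μ * E) *ᵥ f) x = ((D * Grs P a msq k * E) *ᵥ f) x +
      ∑ y'' : Site P k, ((D * Grs P a msq k) *ᵥ pieceFn P k (V P a k μ) ((G0 P a msq k μ * E) *ᵥ f) y'') x := by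
  rw [DG0E_eq ha hm hk1 hk μ, Matrix.add_mulVec, Pi.add_apply]
  congr 1
  have h : (D * Grs P a msq k * (V P a k μ * (G0 P a msq k μ * E))) *ᵥ f =
      (D * Grs P a msq k) *ᵥ (V P a k μ *ᵥ ((G0 P a msq k μ * E) *ᵥ f)) := by
    simp only [Matrix.mulVec_mulVec, Matrix.mul_assoc]
  rw [h, ← sum_pieceFn k (V P a k μ) ((G0 P a msq k μ * E) *ᵥ f), Matrix.mulVec_sum, Finset.sum_apply]

/-- The case D = E = 1: `(G₀f)(x) = (G′f)(x) + Σ_{y″} (G′·piece)(x)`. [cite: Balaban1984PropagatorsI, (1.133) p.39] -/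
theorem G0_apply_pieces (f : Site P 0 → ℝ) (x : Site P 0) :
    (G0 P a msq k μ *ᵥ f) x = (Grs P a msq k *ᵥ f) x +
      ∑ y'' : Site P k, (Grs P a msq k *ᵥ pieceFn P k (V P a k μ) (G0 P a msq k μ *ᵥ f) y'') x := by
  have h := DG0E_apply_pieces ha hm hk1 hk μ 1 1 f x
  simp only [Matrix.one_mul, Matrix.mul_one] at h
  exact h

/-- The case E = 1: `(DG₀f)(x) = (DG′f)(x) + Σ_{y″} (DG′·piece)(x)` (D = ∂_λ: ∇G₀J; D = Δ: ΔG₀J). [cite: Balaban1984PropagatorsI, (1.133) p.39] -/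
theorem DG0_apply_pieces (D : Matrix (Site P 0) (Site P 0) ℝ) (f : Site P 0 → ℝ) (x : Site P 0) :
    ((D * G0 P a msq k μ) *ᵥ f) x = ((D * Grs P a msq k) *ᵥ f) x +
      ∑ y'' : Site P k, ((D * Grs P a msq k) *ᵥ pieceFn P k (V P a k μ) (G0 P a msq k μ *ᵥ f) y'') x := by
  have h := DG0E_apply_pieces ha hm hk1 hk μ D 1 f x
  simp only [Matrix.mul_one] at h
  exact h

/-- The case D = 1: `(G₀Ef)(x) = (G′Ef)(x) + Σ_{y″} (G′·piece′)(x)` (E = ∂*_ν: G₀∇*J). [cite: Balaban1984PropagatorsI, (1.133) p.39] -/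
theorem G0E_apply_pieces (E : Matrix (Site P 0) (Site P 0) ℝ) (f : Site P 0 → ℝ) (x : Site P 0) :
    ((G0 P a msq k μ * E) *ᵥ f) x = ((Grs P a msq k * E) *ᵥ f) x +
      ∑ y'' : Site P k, (Grs P a msq k *ᵥ pieceFn P k (V P a k μ) ((G0 P a msq k μ * E) *ᵥ f) y'') x := by
  have h := DG0E_apply_pieces ha hm hk1 hk μ 1 E f x
  simp only [Matrix.one_mul] at h
  exact h

end Identity

end B5Pieces133Torus

end

end Literature.MathematicalPhysics.QuantumFieldTheory.Balaban1983to89
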